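import Literature.Probability.RandomPlanarGeometry.HexSAWSurfaceWallRenewalTenThree
import HarnessLib

/-!
# The irreducible two-visit block of length twelve and the fourth-order floor `17` of the renewal mean

Brick-wall (honeycomb) self-avoiding walks at an adsorbing surface; positive wall bridges `pwb n`, wall-renewal blocks `ipwb n`,
`Λ_n = IPWB n`, `f_s = pwbLaw · s`, `m = pwbMean`, `β = wallRate` (`HexSAWSurfaceWallRenewal`).  The companions give the renewal
law exactly through half-length five (`f₁ = y/β²`, `f₂ = 0`, `f₃ = y/β⁶`, `f₄ = y/β⁸`, `f₅ = 3y/β¹⁰`: «EXCESS-LIMIT», «EIGHT-UNIQUE»,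
«TEN-THREE») and the fourth-order floor `liminf y⁴ (m − 1 − 2y/β⁶ − 3y/β⁸) ≥ 12` from the three blocks of length ten.

* §1 ★ **The hooked block** `Twelve.qw = (0,0)(1,0)(2,0)(3,0)(3,−1)(2,−1)(2,−2)(3,−2)(4,−2)(4,−1)(5,−1)(5,0)(6,0)`: a positive wall
  bridge of length twelve with TWO surface visits (times `2` and `12`) which is nevertheless IRREDUCIBLE — its row vertex `(2,0)` at
  time `2` is not a wall-renewal time, because the walk comes back to the abscissa `2` at time `5` (`qw_mem_ipwb`, `Twelve.visits_qw`).
  So `N₆₂ ≥ 1` (`one_le_card_twoVisit_ipwb_twelve`), `y² ≤ Λ₁₂(y)` (`sq_le_IPWB_twelve`) and ★ `y²/β(y)¹² ≤ f₆(y)` (`sq_div_le_pwbLaw_six`).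
* §2 ★★ **The fourth-order floor meets the conjectured fourth coefficient**:
  `floor_seventeen : 12y/β¹⁰ + 5y²/β¹² ≤ m(y) − 1 − 2y/β⁶ − 3y/β⁸` (`y > μ⁴`), `tendsto_pow_six_div_wallRate_pow_twelve : y⁶/β¹² → 1`,
  ★★ `eventually_seventeen_sub_le_pow_four_mul_pwbMean : ∀ ε > 0, eventually 17 − ε ≤ y⁴ (m(y) − 1 − 2y/β⁶ − 3y/β⁸)`
  (`liminf ≥ 17 = 4·N₅₁ + 5·1`), `seventeen_le_of_tendsto_pow_four_mul`.

SOURCES.  Positive (wall) bridges, renewal times and irreducible bridges [MadrasSlade1993, Section 1.2, Definition 1.2.4; Section 4.2,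
Definition 4.2.1, (4.2.2)–(4.2.5), Theorem 4.2.2 (pp. 91–92)], [Kesten1963SAW, Section 4], [DuminilCopinHammond2013, Section 2.2
(renewal points, irreducible bridges)]; renewal sequences [Feller1968, XIII.3]; the brickwork honeycomb lattice and exact enumeration of
short surface walks [EntingJensen2009, Section 7.4.2, Fig. 7.10], [JansevanRensburg2000, Section 3.3.2, Lemma 3.20]; the adsorption
fugacity [BeatonBousquetMelouDeGierDuminilCopinGuttmann2014, Section 3.1, Proposition 5]; `μ = √(2+√2)` [DuminilCopinSmirnov2012,
Theorem 1].  The block `qw` and the constant `17` are computed here (lane results, not quotations).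

NOT CLAIMED: `N₆₂ = 1` (brute force: `qw` is the ONLY irreducible two-visit block of length twelve), `N₆₁ = 6`, the vanishing of the
classes `(s, s−4)` for `s ≥ 7` — hence not the fourth-order LIMIT `17`, only the floor; nothing for `y ≤ μ⁴`; no numerics.
-/

namespace Literature.Probability.RandomPlanarGeometry.SAW.HexBW.Wall

open Finset Filter Function
open Literature.Probability.LatticeModels
open _root_.Topology Asymptotics

variable {y : ℝ} {n : ℕ} {ω : ℕ → Site 2}

/-! ### §1  The hooked two-visit block of length twelve -/

namespace Twelve

/-- `X`-table of the hooked block `(0,0)(1,0)(2,0)(3,0)(3,−1)(2,−1)(2,−2)(3,−2)(4,−2)(4,−1)(5,−1)(5,0)(6,0)` (frozen value `6` after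
time 12). [cite: EntingJensen2009, Section 7.4.2, Fig. 7.10] -/
def qX : ℕ → ℤ
  | 0 => 0 | 1 => 1 | 2 => 2 | 3 => 3 | 4 => 3 | 5 => 2 | 6 => 2 | 7 => 3 | 8 => 4 | 9 => 4 | 10 => 5 | 11 => 5 | _ => 6

/-- `Y`-table of the hooked block. [cite: EntingJensen2009, Section 7.4.2, Fig. 7.10] -/
def qY : ℕ → ℤ
  | 4 => -1 | 5 => -1 | 6 => -2 | 7 => -2 | 8 => -2 | 9 => -1 | 10 => -1 | _ => 0

/-- **The hooked block of length twelve** (two surface visits, at times `2` and `12`). [cite: EntingJensen2009, Section 7.4.2, Fig. 7.10] -/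
def qw : ℕ → Site 2 := Tab.walk 12 qX qY

/-- Coordinate facts of the hooked block (a left-proper wall bridge of length twelve), by `decide`. [cite: EntingJensen2009, Section 7.4.2, Fig. 7.10] -/
theorem q_facts : Tab.Facts 12 qX qY := by unfold Tab.Facts; decide

/-- Between the two visits the hooked block is below the row: `Y_k ≠ 0` at the even times `4, 6, 8, 10` (by `decide`).
[cite: EntingJensen2009, Section 7.4.2, Fig. 7.10] -/
theorem q_deep : ∀ k < 12, 3 ≤ k → k % 2 = 0 → qY k ≠ 0 := by decide

/-- Two surface visits (kernel evaluation). [cite: BeatonBousquetMelouDeGierDuminilCopinGuttmann2014, Section 3.1 (arXiv v5 p. 8: the number of contacts with the surface)] -/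
theorem visits_qw : visits 12 qw = 2 := by decide

end Twelve

/-- ★ **The hooked block is an IRREDUCIBLE positive wall bridge of length twelve** (symbolic length): its only row vertex before the
end, `(2,0)` at time `2`, is not a wall-renewal time — the piece after it is not a bridge, since the walk is back at abscissa `2` at
time `5`. [cite: MadrasSlade1993, Section 4.2, Definition 4.2.1] [cite: DuminilCopinHammond2013, Section 2.2] [cite: EntingJensen2009, Section 7.4.2, Fig. 7.10] -/
theorem qw_mem_ipwb {m : ℕ} (hm : m = 12) : Twelve.qw ∈ ipwb m := by
  rw [mem_ipwb]
  refine ⟨mem_pwb_of_facts (w := Twelve.qw) rfl Twelve.q_facts hm, by omega, fun k hk1 hk2 h => ?_⟩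
  obtain ⟨⟨-, -, hb2⟩, hk, hY⟩ := h
  subst hm
  by_cases h3 : 3 ≤ k
  · have hq : Twelve.qY k ≠ 0 := Twelve.q_deep k hk2 h3 hk
    apply hq
    have e : Twelve.qw k = Arm.pt (Twelve.qX k) (Twelve.qY k) := Tab.walk_apply_of_le hk2.le
    rw [e, Arm.pt_apply_one] at hY
    exact hY
  · -- `k = 2`: the second piece `j ↦ qw (2 + j)` is not a bridge (`X₅ = 2 = X₂`)
    have hk2' : k = 2 := by omega
    subst hk2'
    have h := (hb2 3 (by norm_num) (by norm_num)).1
    revert h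
    decide

open Classical in
/-- ★ **`N₆₂ ≥ 1`**: at least one irreducible positive wall bridge of length twelve has two surface visits (symbolic length).
[cite: MadrasSlade1993, Section 4.2, Definition 4.2.1, (4.2.2)] [cite: JansevanRensburg2000, Section 3.3.2, Lemma 3.20] -/
theorem one_le_card_twoVisit_ipwb_twelve {m : ℕ} (hm : m = 12) : 1 ≤ #((ipwb m).filter fun ω => visits m ω = 2) := by
  have hv : visits m Twelve.qw = 2 := by rw [hm]; exact Twelve.visits_qw
  exact Finset.card_pos.2 ⟨_, Finset.mem_filter.2 ⟨qw_mem_ipwb hm, hv⟩⟩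

/-- ★ **`y² ≤ Λ₁₂(y)`** for `y ≥ 0` (symbolic length): the hooked block contributes `y²` to the irreducible polynomial of length twelve.
[cite: MadrasSlade1993, Section 4.2, (4.2.2) (p. 91)] -/
theorem sq_le_IPWB_twelve {m : ℕ} (hm : m = 12) (hy : 0 ≤ y) : y ^ 2 ≤ IPWB m y := by
  have hv : visits m Twelve.qw = 2 := by rw [hm]; exact Twelve.visits_qw
  rw [IPWB]
  have h := Finset.single_le_sum (f := fun ω => y ^ visits m ω) (fun ω _ => pow_nonneg hy _) (qw_mem_ipwb hm)
  rwa [hv] at h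

/-- ★ **`y²/β(y)¹² ≤ f₆(y)`** for `y ≥ 0`. [cite: MadrasSlade1993, Section 4.2, (4.2.2), (4.2.4) (p. 91)] [cite: Kesten1963SAW, Section 4] -/
theorem sq_div_le_pwbLaw_six (hy : 0 ≤ y) : y ^ 2 / wallRate y ^ 12 ≤ pwbLaw y 6 := by
  have key : ∀ m, m = 12 → y ^ 2 / wallRate y ^ 12 ≤ pwbLaw y 6 := by
    intro m hm
    have e : pwbLaw y 6 = IPWB m y / wallRate y ^ m := by rw [pwbLaw, hm]
    have h12 : wallRate y ^ m = wallRate y ^ 12 := by rw [hm]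
    rw [e, h12]
    exact div_le_div_of_nonneg_right (sq_le_IPWB_twelve hm hy) (pow_pos (wallRate_pos y) 12).le
  exact key 12 rfl

/-! ### §2  The fourth-order floor `17` -/

/-- ★★ **`12y/β¹⁰ + 5y²/β¹² ≤ m(y) − 1 − 2y/β⁶ − 3y/β⁸`** (`y > μ⁴`): in `m − 1 = 2f₃ + 3f₄ + 4f₅ + 5f₆ + 6f₇ + Σ_{j≥0}(j+7)f_{j+8}`
every term is nonnegative, `f₃ = y/β⁶`, `f₄ = y/β⁸`, `f₅ = 3y/β¹⁰` and `f₆ ≥ y²/β¹²`.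
[cite: MadrasSlade1993, Section 4.2, (4.2.4)–(4.2.5) and Theorem 4.2.2 (pp. 91–92)] [cite: Feller1968, XIII.3] -/
theorem floor_seventeen (hy : hexConnectiveConstant ^ 4 < y) :
    12 * y / wallRate y ^ 10 + 5 * (y ^ 2 / wallRate y ^ 12) ≤ pwbMean y - 1 - 2 * y / wallRate y ^ 6 - 3 * y / wallRate y ^ 8 := by
  have hy0 : 0 ≤ y := (lt_of_le_of_lt (by positivity) hy).le
  have hnn : 0 ≤ pwbMean y - 1 - (2 * pwbLaw y 3 + 3 * pwbLaw y 4 + 4 * pwbLaw y 5 + 5 * pwbLaw y 6 + 6 * pwbLaw y 7) :=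
    (hasSum_excess_tail_eight hy).nonneg fun j => mul_nonneg (by positivity) (pwbLaw_nonneg hy0 _)
  have h6 := sq_div_le_pwbLaw_six hy0
  have h7 := pwbLaw_nonneg hy0 7
  rw [pwbLaw_three y, pwbLaw_four_eq y, pwbLaw_five_eq y] at hnn
  have e1 : 2 * y / wallRate y ^ 6 = 2 * (y / wallRate y ^ 6) := by ring
  have e2 : 3 * y / wallRate y ^ 8 = 3 * (y / wallRate y ^ 8) := by ring
  have e3 : 12 * y / wallRate y ^ 10 = 4 * (3 * y / wallRate y ^ 10) := by ring
  rw [e1, e2, e3]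
  linarith

/-- `12·(y⁵/β¹⁰) + 5·(y⁶/β¹²) ≤ y⁴ (m(y) − 1 − 2y/β⁶ − 3y/β⁸)` (`y > μ⁴`). [cite: MadrasSlade1993, Section 4.2, (4.2.5) (p. 91)] -/
theorem floor_seventeen_pow_four_mul (hy : hexConnectiveConstant ^ 4 < y) :
    12 * (y ^ 5 / wallRate y ^ 10) + 5 * (y ^ 6 / wallRate y ^ 12) ≤
      y ^ 4 * (pwbMean y - 1 - 2 * y / wallRate y ^ 6 - 3 * y / wallRate y ^ 8) := by
  have hy0 : 0 < y := lt_of_le_of_lt (by positivity) hy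
  have h := floor_seventeen hy
  have e1 : 12 * (y ^ 5 / wallRate y ^ 10) + 5 * (y ^ 6 / wallRate y ^ 12) =
      y ^ 4 * (12 * y / wallRate y ^ 10 + 5 * (y ^ 2 / wallRate y ^ 12)) := by ring
  rw [e1]
  exact mul_le_mul_of_nonneg_left h (pow_pos hy0 4).le

/-- `y⁶/β(y)¹² → 1` (`β ∼ √y`). [cite: BeatonBousquetMelouDeGierDuminilCopinGuttmann2014, Section 3.1, Proposition 5 (arXiv v5 p. 9)] -/
theorem tendsto_pow_six_div_wallRate_pow_twelve : Tendsto (fun y : ℝ => y ^ 6 / wallRate y ^ 12) atTop (𝓝 1) := by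
  have h1 : Tendsto (fun y : ℝ => ((wallRate y / Real.sqrt y) ^ 12)⁻¹) atTop (𝓝 ((1 : ℝ) ^ 12)⁻¹) :=
    (tendsto_wallRate_div_sqrt.pow 12).inv₀ (by norm_num)
  rw [one_pow, inv_one] at h1
  refine h1.congr' ?_
  filter_upwards [eventually_gt_atTop (0 : ℝ)] with y hy
  have hs : Real.sqrt y ^ 12 = y ^ 6 := by
    rw [show (12 : ℕ) = 2 * 6 by norm_num, pow_mul, Real.sq_sqrt hy.le]
  rw [div_pow, hs, inv_div]

/-- ★★ **`liminf_{y→∞} y⁴ (m(y) − 1 − 2y/β(y)⁶ − 3y/β(y)⁸) ≥ 17`** — the floor meets the conjectured fourth coefficient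
`4·N₅₁ + 5·N₆₂ = 4·3 + 5·1`: for every `ε > 0`, eventually `17 − ε ≤ y⁴ (m(y) − 1 − 2y/β⁶ − 3y/β⁸)`.
[cite: MadrasSlade1993, Section 4.2, (4.2.5) (p. 91)] [cite: JansevanRensburg2000, Section 3.3.2, Lemma 3.20] -/
theorem eventually_seventeen_sub_le_pow_four_mul_pwbMean {ε : ℝ} (hε : 0 < ε) :
    ∀ᶠ y : ℝ in atTop, 17 - ε ≤ y ^ 4 * (pwbMean y - 1 - 2 * y / wallRate y ^ 6 - 3 * y / wallRate y ^ 8) := by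
  have h1 : ∀ᶠ y : ℝ in atTop, 1 - ε / 17 < y ^ 5 / wallRate y ^ 10 :=
    tendsto_pow_five_div_wallRate_pow_ten.eventually (eventually_gt_nhds (by linarith))
  have h2 : ∀ᶠ y : ℝ in atTop, 1 - ε / 17 < y ^ 6 / wallRate y ^ 12 :=
    tendsto_pow_six_div_wallRate_pow_twelve.eventually (eventually_gt_nhds (by linarith))
  filter_upwards [h1, h2, eventually_gt_atTop (hexConnectiveConstant ^ 4)] with y hy1 hy2 hy3
  have h3 := floor_seventeen_pow_four_mul hy3
  linarith

/-- ★ If the fourth-order limit `L = lim y⁴ (m(y) − 1 − 2y/β⁶ − 3y/β⁸)` exists, then `17 ≤ L` (the conjectured value is `17`; the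
matching upper bound needs the vanishing of the classes `(s, s−4)` for `s ≥ 7`, not attempted). [cite: MadrasSlade1993, Section 4.2, (4.2.5) (p. 91)] -/
theorem seventeen_le_of_tendsto_pow_four_mul {L : ℝ}
    (hL : Tendsto (fun y : ℝ => y ^ 4 * (pwbMean y - 1 - 2 * y / wallRate y ^ 6 - 3 * y / wallRate y ^ 8)) atTop (𝓝 L)) :
    17 ≤ L := by
  have h17 : Tendsto (fun y : ℝ => 12 * (y ^ 5 / wallRate y ^ 10) + 5 * (y ^ 6 / wallRate y ^ 12)) atTop (𝓝 17) := by
    have h := (tendsto_pow_five_div_wallRate_pow_ten.const_mul 12).add (tendsto_pow_six_div_wallRate_pow_twelve.const_mul 5)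
    norm_num at h
    exact h
  refine le_of_tendsto_of_tendsto h17 hL ?_
  filter_upwards [eventually_gt_atTop (hexConnectiveConstant ^ 4)] with y hy
  exact floor_seventeen_pow_four_mul hy

end Literature.Probability.RandomPlanarGeometry.SAW.HexBW.Wall
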